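import Summits.QuantumFields.YangMills.Theorems.AlphaInputsT3ACv3LinearLiftMatrixTwistS
import HarnessLib

/-!
# `AlphaInputsT3ACv3LinearLiftMatrixTwistCurl` — (V) THE MATRIX-VALUED PORT OF THE (LL) ENGINE, PART 10 = row (r1-curl) of the 19936 (FL) START∕STEP of record (★★OWNER g25 RULING
# 2026-08-28T02:16:33Z; LEAD memo `NONABELIAN-FL-START-w1-g2.md` §2): ★★ the CURL ROW OF THE TWISTED SUP-SMALL LIFT — for contractive frames `ψ` that vary by at most `θ′` between the bonds
# of one finest plaquette, `‖curlM (liftSMTw k ψ u) (x;μ,ν)‖ ≤ (4·18^d∕(L^k)²)·M + 3·(C_S∕L^k)·θ′·M` (`‖u‖ ≤ M`) — the twin of part 5's `norm_curlM_liftSCLM_le` for the transport-framed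
# Newton right inverse `(R u)(b) = Σ_c w(b,c)·Ad(P_U(b₋ ← ĉ₋))·u(c)` — cell `ym3-torus`, width seat `ym-ust-19936-w3` (g0)

WHY (memo v3 §2, «what (r1) must be»): the STEP of the `hLift` contraction is ONE global shell whose right inverse is ★w2 g2's sup-small lift `liftS` twisted by the transport frames of the
CURRENT fine field; in the fine comb-axial gauge the frames are `1 + O(d²π)` (θ, for the exactness defect `norm_linAvgIterM_liftSMTw_sub_le`, part 6) AND fine-Lipschitz ACROSS faces,
`‖ψ(b,c) − ψ(b′,c)‖ ≤ θ′ = O(πL^{−k})` for neighbouring `b, b′` — so the curl of the framed correction must be bounded by the curl row of the unframed lift plus `O(θ′·‖R‖)`.  THIS FILE: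
* §16 `byEntryTw_sub_frames` (the twisted port is additive in the frames), `byEntryTw_frozen` (frames independent of the OUTPUT bond = the untwisted port of the rotated data, kernel form),
  ★ `norm_byEntryTw_le_of_frameBound` (frames bounded by `θ` in operator norm on the sub-family ⇒ `‖byEntryTw T ψ A b‖ ≤ C·(θ·M)`, same kernel `ℓ¹`-mass device as part 4).
* §17 `liftSMTw_frozen : liftSMTw k (fun _ c => φ c) u = liftSM k (fun c => φ c (u c))`, `norm_liftSMTw_sub_frozen_le` (`‖liftSMTw k ψ u b − liftSM k (c ↦ ψ b₁ c (u c)) b‖ ≤ (C_S∕L^k)·θ′·M`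
  when `‖ψ b c X − ψ b₁ c X‖ ≤ θ′‖X‖`), and ★★ `norm_curlM_liftSMTw_le` (the display above: frozen-frame part by part 5's `norm_curlM_liftSM_le_local` + `norm_curlM_le_four_mul_norm` on the
  rotated data — contractive frames keep `‖ψ b₁ c (u c)‖ ≤ M`; the three other bonds of the plaquette each cost the kernel `ℓ¹`-mass `C_S∕L^k` times `θ′·M`).
HONEST FRAMING.  Finite-dimensional real linear algebra; the frames are ABSTRACT (no transport is constructed here — that is (r1-T)∕★w4's); nothing of [Balaban1985UV3]∕
[Balaban1985Variational]∕[Balaban1985Averaging] is asserted; (FL)∕`hLift`, the stub 2′χ, the crux `HistoryTailL` and any gap are NOT claimed; count-neutral helper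
(`--supports stmt-QuantumFields-19936`); registry untouched.  YM₃ on the three-torus is a RUNG of the programme, not the Clay problem; nothing here is about d = 4, infinite volume or a mass gap.

References: T. Bałaban, Commun. Math. Phys. 109 (1987) 249–301 [Balaban1987RG1] ((0.4), (0.11) p.253); Commun. Math. Phys. 98 (1985) 17–51 [Balaban1985Averaging] ((9), (11)
pp.18–19: gauge covariance of the averaging; (19) p.21).
-/

set_option autoImplicit false

noncomputable section

open scoped Matrix.Norms.L2Operator

namespace Summit.QuantumFields.YangMills.Theorems.LinearLiftMatrix

open Finset
open Literature.MathematicalPhysics.QuantumFieldTheory.Balaban1983to89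
open Literature.MathematicalPhysics.QuantumFieldTheory.Balaban1985CMP102.Setting
open Summit.QuantumFields.Balaban3D.Carriers
open Summit.QuantumFields.YangMills.Theorems.LinearLiftSpread (liftS liftSL liftSL_apply Near near_self)

/-! ## §16 The twisted port: additivity in the frames, frozen frames, θ-bounded frames -/

section Frames

variable {n : Type*} {ι κ : Type*} [Fintype ι] [DecidableEq ι]

/-- **THE TWISTED PORT IS ADDITIVE IN THE FRAMES**: `byEntryTw T ψ A b − byEntryTw T ψ′ A b = byEntryTw T (ψ − ψ′) A b`. [folklore] -/
theorem byEntryTw_sub_frames (T : (ι → ℝ) →ₗ[ℝ] (κ → ℝ)) (ψ ψ' : κ → ι → Matrix n n ℂ →ₗ[ℝ] Matrix n n ℂ) (A : ι → Matrix n n ℂ) (b : κ) :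
    byEntryTw T ψ A b - byEntryTw T ψ' A b = byEntryTw T (fun b c => ψ b c - ψ' b c) A b := by
  rw [byEntryTw_def, byEntryTw_def, byEntryTw_def, ← sum_sub_distrib]
  exact sum_congr rfl fun c _ => by rw [LinearMap.sub_apply, smul_sub]

/-- **FROZEN FRAMES = THE UNTWISTED PORT OF THE ROTATED DATA**: if the frames do not depend on the output bond, `byEntryTw T (fun _ c => φ c) A b = byEntry T (fun c => φ c (A c)) b`. [folklore] -/
theorem byEntryTw_frozen (T : (ι → ℝ) →ₗ[ℝ] (κ → ℝ)) (φ : ι → Matrix n n ℂ →ₗ[ℝ] Matrix n n ℂ) (A : ι → Matrix n n ℂ) (b : κ) :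
    byEntryTw T (fun _ c => φ c) A b = byEntry T (fun c => φ c (A c)) b := by
  rw [byEntryTw_def, byEntry_eq_sum_kernel]

variable [Fintype n] [DecidableEq n]

/-- **★ THE PORT OF AN `ℓ^∞` BOUND THROUGH `θ`-BOUNDED FRAMES**: if `|T f (b)| ≤ C·M` whenever `|f c| ≤ M` on `N`, and `‖ψ b c X‖ ≤ θ·‖X‖` on `N`, then `‖byEntryTw T ψ A b‖ ≤ C·(θ·M)`
whenever `‖A c‖ ≤ M` on `N` (part 4's contractive case is `θ = 1`). [folklore] -/
theorem norm_byEntryTw_le_of_frameBound (T : (ι → ℝ) →ₗ[ℝ] (κ → ℝ)) (ψ : κ → ι → Matrix n n ℂ →ₗ[ℝ] Matrix n n ℂ) (N : ι → Prop) (b : κ) {C : ℝ}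
    (hT : ∀ (f : ι → ℝ) (M : ℝ), (∀ c, N c → |f c| ≤ M) → |T f b| ≤ C * M) {θ : ℝ} (hθ : 0 ≤ θ) (hψ : ∀ c, N c → ∀ X, ‖ψ b c X‖ ≤ θ * ‖X‖)
    (A : ι → Matrix n n ℂ) {M : ℝ} (hM : 0 ≤ M) (hA : ∀ c, N c → ‖A c‖ ≤ M) :
    ‖byEntryTw T ψ A b‖ ≤ C * (θ * M) := by
  classical
  rw [byEntryTw_def]
  have hterm : ∀ c, ‖(T (Pi.single c 1) b) • ψ b c (A c)‖ ≤ |T (Pi.single c 1) b| * (θ * M) := fun c => by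
    rw [norm_smul, Real.norm_eq_abs]
    by_cases hc : N c
    · exact mul_le_mul_of_nonneg_left ((hψ c hc _).trans (mul_le_mul_of_nonneg_left (hA c hc) hθ)) (abs_nonneg _)
    · rw [kernel_eq_zero_of_bound T N b hT hc, abs_zero, zero_mul, zero_mul]
  calc ‖∑ c, (T (Pi.single c 1) b) • ψ b c (A c)‖ ≤ ∑ c, |T (Pi.single c 1) b| * (θ * M) := norm_sum_le_of_le _ fun c _ => hterm c
    _ = (∑ c, |T (Pi.single c 1) b|) * (θ * M) := by rw [sum_mul]
    _ ≤ C * (θ * M) := mul_le_mul_of_nonneg_right (sum_abs_kernel_le_of_bound T N b hT) (mul_nonneg hθ hM)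

end Frames

/-! ## §17 The curl row of the twisted sup-small lift -/

section TwistCurl

variable {P : Params} {n : Type*} (k : ℕ) (ψ : PBond P 0 → PBond P k → Matrix n n ℂ →ₗ[ℝ] Matrix n n ℂ)

/-- `‖curlM u y μ ν‖ ≤ 4·M` from the pointwise bound `‖u c‖ ≤ M`. [folklore] -/
theorem norm_curlM_le_four_mul_of_bound [Fintype n] [DecidableEq n] {j : ℕ} (u : PBond P j → Matrix n n ℂ) {M : ℝ} (hu : ∀ c, ‖u c‖ ≤ M) (y : Site P j) (μ ν : Fin P.d) :
    ‖curlM u y μ ν‖ ≤ 4 * M := by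
  unfold curlM
  calc ‖u ⟨y, μ⟩ + u ⟨y.shift μ, ν⟩ - u ⟨y.shift ν, μ⟩ - u ⟨y, ν⟩‖
      ≤ ‖u ⟨y, μ⟩‖ + ‖u ⟨y.shift μ, ν⟩‖ + ‖u ⟨y.shift ν, μ⟩‖ + ‖u ⟨y, ν⟩‖ := by
        refine (norm_sub_le _ _).trans ?_
        refine add_le_add ((norm_sub_le _ _).trans (add_le_add (norm_add_le _ _) le_rfl)) le_rfl
    _ ≤ M + M + M + M := by gcongr <;> exact hu _
    _ = 4 * M := by ring

/-- **FROZEN FRAMES**: `liftSMTw k (fun _ c => φ c) u = liftSM k (fun c => φ c (u c))` — framing by bond-independent maps is lifting the rotated data. [cite: Balaban1985Averaging, (11) p.19] -/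
theorem liftSMTw_frozen (φ : PBond P k → Matrix n n ℂ →ₗ[ℝ] Matrix n n ℂ) (u : PBond P k → Matrix n n ℂ) :
    liftSMTw k (fun _ c => φ c) u = liftSM k (fun c => φ c (u c)) := by
  classical
  funext b
  rw [liftSMTw_eq, liftSM_eq, byEntry_congr (T := liftS k) (fun f => (liftSL_apply k f).symm)]
  convert byEntryTw_frozen (liftSL P k) φ u b

variable (hk : k ≤ P.m + P.K) [Fintype n] [DecidableEq n]
include hk

/-- **THE FRAME-VARIATION COST AT ONE BOND**: if `‖ψ b c X − ψ b₁ c X‖ ≤ θ′·‖X‖` for every `c` and `‖u c‖ ≤ M`, then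
`‖liftSMTw k ψ u b − liftSM k (fun c => ψ b₁ c (u c)) b‖ ≤ (C_S∕L^k)·(θ′·M)` — the kernel `ℓ¹`-mass of `liftS` at `b` times the frame variation. [cite: Balaban1987RG1, (0.4)+(0.11) p.253] -/
theorem norm_liftSMTw_sub_frozen_le (u : PBond P k → Matrix n n ℂ) (b b₁ : PBond P 0) {θ' M : ℝ} (hθ' : 0 ≤ θ')
    (hψ : ∀ c X, ‖ψ b c X - ψ b₁ c X‖ ≤ θ' * ‖X‖) (hu : ∀ c, ‖u c‖ ≤ M) :
    ‖liftSMTw k ψ u b - liftSM k (fun c => ψ b₁ c (u c)) b‖ ≤ (CS P / (P.L : ℝ) ^ k) * (θ' * M) := by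
  classical
  have hM : 0 ≤ M := (norm_nonneg _).trans (hu ⟨fun _ => 0, b.dir⟩)
  have hfro : liftSM k (fun c => ψ b₁ c (u c)) b = liftSMTw k (fun _ c => ψ b₁ c) u b := by rw [liftSMTw_frozen]
  rw [hfro, liftSMTw_eq, liftSMTw_eq, byEntryTw_sub_frames]
  exact norm_byEntryTw_le_of_frameBound (liftSL P k) _ (fun _ => True) b (fun f M' hf => abs_liftS_le' k hk f (fun c => hf c trivial) b) hθ'
    (fun c _ X => by simpa using hψ c X) u hM fun c _ => hu c

/-- **★★ THE CURL ROW OF THE TWISTED SUP-SMALL LIFT (r1-curl)**: for CONTRACTIVE frames (`‖ψ b c X‖ ≤ ‖X‖`) whose variation between the base bond `b₁ = (x, μ)` of the finest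
plaquette at `(x; μ, ν)` and its three other bonds is at most `θ′` (`‖ψ bᵢ c X − ψ b₁ c X‖ ≤ θ′·‖X‖`), and data `‖u c‖ ≤ M`:
`‖curlM (liftSMTw k ψ u) x μ ν‖ ≤ (4·18^d∕(L^k)²)·M + 3·(C_S∕L^k)·(θ′·M)` — the frozen-frame part is the untwisted curl row on the rotated data (part 5), each of the three other bonds
costs the kernel `ℓ¹`-mass `C_S∕L^k` times `θ′·M`. [cite: Balaban1985Averaging, (9)+(11) pp.18–19; Balaban1987RG1, (0.4)+(0.11) p.253] -/
theorem norm_curlM_liftSMTw_le (hψc : ∀ b c X, ‖ψ b c X‖ ≤ ‖X‖) (u : PBond P k → Matrix n n ℂ) {M : ℝ} (hu : ∀ c, ‖u c‖ ≤ M) (x : Site P 0) {μ ν : Fin P.d} (hμν : μ ≠ ν)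
    {θ' : ℝ} (hθ' : 0 ≤ θ')
    (hψ₂ : ∀ c X, ‖ψ ⟨x.shift μ, ν⟩ c X - ψ ⟨x, μ⟩ c X‖ ≤ θ' * ‖X‖) (hψ₃ : ∀ c X, ‖ψ ⟨x.shift ν, μ⟩ c X - ψ ⟨x, μ⟩ c X‖ ≤ θ' * ‖X‖)
    (hψ₄ : ∀ c X, ‖ψ ⟨x, ν⟩ c X - ψ ⟨x, μ⟩ c X‖ ≤ θ' * ‖X‖) :
    ‖curlM (liftSMTw k ψ u) x μ ν‖ ≤ (4 * (18 : ℝ) ^ P.d / ((P.L : ℝ) ^ k) ^ 2) * M + 3 * ((CS P / (P.L : ℝ) ^ k) * (θ' * M)) := by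
  -- the rotated data in the frame of the base bond `b₁ = (x, μ)` and its untwisted lift
  set b₁ : PBond P 0 := ⟨x, μ⟩ with hb₁
  set A' : PBond P k → Matrix n n ℂ := fun c => ψ b₁ c (u c) with hA'
  set Y : PBond P 0 → Matrix n n ℂ := liftSMTw k ψ u with hY
  set Z : PBond P 0 → Matrix n n ℂ := liftSM k A' with hZ
  have hA'M : ∀ c, ‖A' c‖ ≤ M := fun c => (hψc b₁ c (u c)).trans (hu c)
  -- frozen-frame part: the untwisted curl row on the rotated data
  have hZcurl : ‖curlM Z x μ ν‖ ≤ (18 : ℝ) ^ P.d * (4 * M) / ((P.L : ℝ) ^ k) ^ 2 :=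
    norm_curlM_liftSM_le_local k hk A' x hμν fun y _ => norm_curlM_le_four_mul_of_bound A' hA'M y μ ν
  -- the frame-variation part, bond by bond
  have h₁ : Y b₁ - Z b₁ = 0 := by
    rw [hY, hZ, hA']
    have h := norm_liftSMTw_sub_frozen_le k ψ hk u b₁ b₁ le_rfl (fun c X => by rw [sub_self, norm_zero, zero_mul]) hu
    rw [zero_mul, mul_zero] at h
    exact norm_le_zero_iff.mp h
  have h₂ : ‖Y ⟨x.shift μ, ν⟩ - Z ⟨x.shift μ, ν⟩‖ ≤ (CS P / (P.L : ℝ) ^ k) * (θ' * M) := norm_liftSMTw_sub_frozen_le k ψ hk u _ b₁ hθ' hψ₂ hu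
  have h₃ : ‖Y ⟨x.shift ν, μ⟩ - Z ⟨x.shift ν, μ⟩‖ ≤ (CS P / (P.L : ℝ) ^ k) * (θ' * M) := norm_liftSMTw_sub_frozen_le k ψ hk u _ b₁ hθ' hψ₃ hu
  have h₄ : ‖Y ⟨x, ν⟩ - Z ⟨x, ν⟩‖ ≤ (CS P / (P.L : ℝ) ^ k) * (θ' * M) := norm_liftSMTw_sub_frozen_le k ψ hk u _ b₁ hθ' hψ₄ hu
  -- split the curl
  have hsplit : curlM Y x μ ν = curlM Z x μ ν + ((Y b₁ - Z b₁) + (Y ⟨x.shift μ, ν⟩ - Z ⟨x.shift μ, ν⟩) - (Y ⟨x.shift ν, μ⟩ - Z ⟨x.shift ν, μ⟩) - (Y ⟨x, ν⟩ - Z ⟨x, ν⟩)) := by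
    simp only [curlM, hb₁]; abel
  rw [hsplit, h₁, zero_add]
  calc ‖curlM Z x μ ν + ((Y ⟨x.shift μ, ν⟩ - Z ⟨x.shift μ, ν⟩) - (Y ⟨x.shift ν, μ⟩ - Z ⟨x.shift ν, μ⟩) - (Y ⟨x, ν⟩ - Z ⟨x, ν⟩))‖
      ≤ ‖curlM Z x μ ν‖ + (‖Y ⟨x.shift μ, ν⟩ - Z ⟨x.shift μ, ν⟩‖ + ‖Y ⟨x.shift ν, μ⟩ - Z ⟨x.shift ν, μ⟩‖ + ‖Y ⟨x, ν⟩ - Z ⟨x, ν⟩‖) := by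
        refine (norm_add_le _ _).trans (add_le_add le_rfl ?_)
        exact (norm_sub_le _ _).trans (add_le_add ((norm_sub_le _ _).trans le_rfl) le_rfl)
    _ ≤ (18 : ℝ) ^ P.d * (4 * M) / ((P.L : ℝ) ^ k) ^ 2 + 3 * ((CS P / (P.L : ℝ) ^ k) * (θ' * M)) := by linarith
    _ = (4 * (18 : ℝ) ^ P.d / ((P.L : ℝ) ^ k) ^ 2) * M + 3 * ((CS P / (P.L : ℝ) ^ k) * (θ' * M)) := by ring

end TwistCurl

end Summit.QuantumFields.YangMills.Theorems.LinearLiftMatrix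

end
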